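import Summits.HodgeConjecture.HodgeConjecture.Theorems.UeP4bLocalPeriodMatrixFamily
import HarnessLib

/-!
# U-e P4 (B1b), FAMILY EDITION, part 2: Siegel-normalised Hodge-frame markings with chart-holomorphic period point,
# for ANY smooth projective family — the (B1b) socket made local on the base

Cell hodgecm-mathlib (D-0151), rung 0 of the Mumford line under `HDel` (item `stmt-HodgeConjecture-24835`), (U)-lane node
U-e P4, PIECE EDITION (B-plan1 (g13) GO-PIECE 2026-08-29T18:25Z, lead B-p03 (g14): «P4 is local on the base»).  This file is
★ `UeP4bHodgeFrameMarkings` (`ueP4b1b_hodgeFrameMarkings`, the socket (B1b) for the complexified universal family over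
`M ⊗ ℂ`) made GENERIC IN THE FAMILY, over `UeP4bLocalPeriodMatrixFamily`: the base is any `S` smooth of pure dimension `d`
and quasi-projective, the family any smooth projective `f : 𝒳 → S` of relative dimension `g` with `𝒳` quasi-projective,
cohomologically locally trivial over the open `W ⊆ S(ℂ)`, and the fibre triples `P′ x` are identified with the fibres `X_x`
by ARBITRARY isomorphisms `εA x` (pinned on complex points as `e x := homeomorphOfIso (εA x)`).  The universal-family
binders `(𝓜, hMq, hXq, G, Ĝ, hbc, cls)` of ★ p731374 become `(f, hf, hS, h𝒳, εA)`; every other binder and the whole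
conclusion are unchanged token for token (charts `algebraicChart S d`).  Instances: ★ p731374's statement
(`f := univFamilyℂ 𝓜`) and the piece family `familyPullback.snd (univFamilyℂ 𝓜) ι` over an open piece `ι : S′ → M ⊗ ℂ`
(fibre seam ★ `fiberOverFamilyPullbackIso`), which is what the E-road «EQUIDIM from (F)» consumes.  HC_CM is proved only
modulo the 7 printed citations until rung 0 closes; nothing in this file changes that count (a (U)-road leaf, books 0).

THE PROOF is ★ p731374's verbatim with `exists_local_periodMatrix_family` in place of `exists_local_periodMatrix`:
per-fibre markings ★ `exists_marking_of_gramClause` (Gram `E_δ` everywhere from (G₀) at `x₀` and the flat-Gram hypothesis,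
currency transport ★ `gramClause_of/to_marking`, `frameClause_to_marking`); `π x₀ = Z₀` by ★ `siegelPoint_eq_of_apply_jOfSiegel`;
the level reading from `Λ₀` (★ `lift_level`, ★ `exists_adelicCongr_inv_one`, ★ `r_eq_toFun_proj_of_γ_eq_one`); continuity and
chart-holomorphy of `π` on `W` from the local period formula through ★ P4d `differentiableOn_siegelPoint_of_periodMatrix` and ★
`differentiableOn_comp_algebraicChart_symm_of_differentiableOn`.

## References

* [LangeBirkenhake1992] H. Lange, Ch. Birkenhake, *Complex Abelian Varieties* (1992), Ch. 8 §8.1–8.2 (Prop. 8.1.1).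
* [VoisinHodgeI2002] C. Voisin, *Hodge Theory and Complex Algebraic Geometry I* (2002), §9.2.1, §10.1.2 Thm. 10.9, §10.2.1 Thm. 10.3.
* [Griffiths1968PeriodsII] P. Griffiths, Periods of integrals on algebraic manifolds II, Amer. J. Math. 90 (1968), Thm. 1.1.
* [Milne2005ShimuraVarieties] J. S. Milne, *Introduction to Shimura Varieties* (2005), §6 Thm. 6.11 pp. 74–75, §12 (63) p. 116.
* [Lange2023AbelianVarietiesComplex] H. Lange, *Abelian Varieties over the Complex Numbers* (2023), §1.1.3 Lemma 1.1.17 (a) (p. 14),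
  §2.1.3 Prop. 2.1.11 (p. 80), §7.1.2 Lemma 7.1.6 (pp. 350–352).
* [MumfordFogartyKirwan1994] D. Mumford, J. Fogarty, F. Kirwan, *Geometric Invariant Theory* (3rd ed.), Appendix to Ch. 7 §A (p. 235).
-/

set_option autoImplicit false
set_option linter.dupNamespace false

noncomputable section

open CategoryTheory CategoryTheory.Limits AlgebraicGeometry Matrix Topology
open Literature.AlgebraicGeometry
open scoped TensorProduct Manifold
open Literature.AlgebraicGeometry.Motives (SchemeOver ComplexPoints AlgPoints specOver AbelianVariety CartierDivisor fiberOver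
  IsSmoothProjective ofRatClassBaseChange)
open Literature.AlgebraicGeometry.AbelianSchemes (PolarizedAbelianSchemeWithLevel AbelianSchemeOver)
open Literature.Geometry.Kaehler (ComplexTorus)
open Literature.Geometry.Kaehler.ComplexTorus (AHData periodMatrix intGram latticeGram IsRiemannForm proj picClass)
open Literature.NumberTheory.Transcendental (IsAnalytification)
open Literature.NumberTheory.Automorphic (siegelUpperHalfSpace)
open Literature.NumberTheory.Adeles
open Literature.AlgebraicTopology.SingularHomology
open Literature.AlgebraicGeometry.ModuliOfAbelianVarieties
open Literature.AlgebraicGeometry.HodgeTheory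

namespace Summit.HodgeConjecture.HodgeConjecture.Theorems

namespace UeP4bHodgeFrameMarkings

open SiegelModuli
/-! ### §4′ The socket (B1b), notion-free, FAMILY EDITION -/

section Main

/-- **U-e P4 (B1b), FAMILY EDITION — SIEGEL-NORMALISED HODGE-FRAME MARKINGS for ANY smooth projective family `f : 𝒳 → S`
(relative dimension `g`; `S`, `𝒳` quasi-projective; `S` smooth of pure dimension `d`) with fibre triples `P′ x` identified with
the fibres by ARBITRARY isomorphisms `εA x` (★ `ueP4b1b_hodgeFrameMarkings` is the instance `f := univFamilyℂ 𝓜`,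
`εA x := fibreAVIso ≪≫ fiberUnivIso⁻¹`; the PIECE edition is the instance `f := familyPullback.snd (univFamilyℂ 𝓜) ι`).**
HYPOTHESES = the (B1b) socket's with `(𝓜, hMq, hXq, G, Ĝ, hbc, cls)` replaced by `(f, hf, hS, h𝒳, εA)` and the HOME notion
`IsFlatIntegralFrame` by its three clauses (only (iii) used).  CONCLUSION = the socket's with the HOME notions `SiegelMarkingFamily` /
`IsMarkingFrame` / `IsFlatGram` / `IsSiegelNormalised` unfolded: a period map `π`, points `J x ∈ S^±` and T1′ markings `mark x`
of the fibres `A_x = ((P′ x).A.fibre 𝟙).toAbelianVariety` by `[J x, r]` which ARE the given uniformisations (`γ = 1`, `Ψ = Φ x`,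
`toFun = φ x`), whose lattice frames through the pinned `e x` are `γ x`, whose line bundles `𝒪(Θ x)^an` have Appell–Humbert
Gram `E_δ`, with `J x = J(π x)`, `π` continuous on `W` and holomorphic in every algebraic chart, `π x₀ = Z₀`, and the level
sections reading through `mark x₀` at the classes `eᵢ/N`.  The glue re-packages `(J, mark)` as a `SiegelMarkingFamily`.
PROOF: §2 at every fibre (Gram `E_δ` everywhere from (G₀) at `x₀`, §1, and the flat-Gram hypothesis (N3)); `π x₀ = Z₀` by ★
`siegelPoint_eq_of_apply_jOfSiegel` (the admissibility marking `m₀` has `γ = 1`, `Ψ = Φ x₀`); the level reading from `Λ₀`'s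
tower (★ `lift_level`, ★ `exists_adelicCongr_inv_one`); continuity and chart-holomorphy of `π` on `W` from the local period
formula §3, ★ P4d `differentiableOn_siegelPoint_of_periodMatrix` and the chart transfer ★
`differentiableOn_comp_algebraicChart_symm_of_differentiableOn`.  HC_CM is proved only modulo the 7 printed citations until
rung 0 closes; this helper changes no count (books 0). [cite: LangeBirkenhake1992, Ch. 8 §8.1–8.2 (Prop. 8.1.1)]
[cite: VoisinHodgeI2002, §10.2.1 Thm. 10.3 and §10.1.2 Thm. 10.9] [cite: Milne2005ShimuraVarieties, §6 Thm. 6.11 pp. 74–75 and §12 (63) p. 116]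
[cite: Lange2023AbelianVarietiesComplex, §7.1.2 Lemma 7.1.6 (pp. 350–352)] -/
theorem ueP4b1b_hodgeFrameMarkings_family :
  ∀ (g N : ℕ) (δ : Fin g → ℕ) (_hg : 0 < g) (hδ : IsPolarizationType δ) (_hN : 3 ≤ N)
    {𝒳 S : SchemeOver ℂ} (f : 𝒳 ⟶ S) (_hf : Motives.IsSmoothProjectiveFamily f g)
    (_hS : IsQuasiProjectiveOver S) (_h𝒳 : IsQuasiProjectiveOver 𝒳)
    (r : gspFinAdelic δ)
    (d : ℕ) [SmoothOfRelativeDimension d S.hom],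
    haveI : IsLocallyNoetherian (specOver ℚ ℂ).left :=
      inferInstanceAs (IsLocallyNoetherian (Spec (CommRingCat.of ℂ)))
    haveI : Smooth S.hom := SmoothOfRelativeDimension.smooth d _
    haveI : LocallyOfFiniteType S.hom := inferInstance
    r ∈ principalLevelSubgroup δ 1 →
    ∀ (Z₀ : Matrix (Fin g) (Fin g) ℂ) (hZ₀ : Z₀ ∈ siegelUpperHalfSpace g)
      (W : Set (ComplexPoints S)) (_hWo : IsOpen W) (_hW : IsPathConnected W)
      (x₀ : W)
      (_hWc : W ⊆ (ComplexPoints.algebraicChart S d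
        (x₀ : ComplexPoints S)).source)
      (hU : IsCohomologicallyLocallyTrivialOn f W)
      (P' : W → PolarizedAbelianSchemeWithLevel g N δ (specOver ℚ ℂ).left)
      (εA : ∀ x : W, (W1.fibreAV (P' x)).X ≅ fiberOver f x.1)
      (γ : ∀ x : W, Fin g ⊕ Fin g →
        singularCohomology ℚ ℚ (ComplexPoints (fiberOver f x.1)) 1)
      (Φ : ∀ _x : W, (Fin g ⊕ Fin g → ℝ) ≃L[ℝ] (Fin g → ℂ))
      (φ : ∀ x : W, C(ComplexTorus (Φ x), ((P' x).A.fibre (𝟙 (Spec (CommRingCat.of ℂ)))).toAbelianVariety.Points ℂ))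
      (Θ : ∀ x : W, CartierDivisor ((P' x).A.fibre (𝟙 (Spec (CommRingCat.of ℂ)))).toAbelianVariety.X.left)
      (m₀ : SiegelAdelicMarking ⟨jOfSiegel δ Z₀, SiegelComplexRecordSystem.jOfSiegel_mem_C0pm hδ.1 hZ₀⟩ r
        ((P' x₀).A.fibre (𝟙 (Spec (CommRingCat.of ℂ)))).toAbelianVariety)
      (Λ₀ : (P' x₀).level.SymplecticLift (𝟙 (Spec (CommRingCat.of ℂ))) (Θ x₀) δ),
      -- (N1) `γ` is a flat integral frame over `W`: the three clauses of B-typ02's HOME notion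
      -- `HodgeTheory.IsFlatIntegralFrame f hU γ` (only (iii), flatness inside `W`, is used here)
      ((∀ x : W, LinearIndependent ℂ fun a => ofRatClass _ 1 (γ x a)) ∧
        (∀ (x : W) (c : complexBetti (fiberOver f x.1) 1),
          IsIntegralClass c ↔ c ∈ Submodule.span ℤ (Set.range fun a => ofRatClass _ 1 (γ x a))) ∧
        ∀ (x x' : W) (p : Path.Homotopic.Quotient x x') (a : Fin g ⊕ Fin g),
          transportFun f 1 hU p (ofRatClass _ 1 (γ x a)) = ofRatClass _ 1 (γ x' a)) →
      -- the uniformisations: analytifications, additive, framed by `γ x` through the pinned `e x`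
      (hφ : ∀ x : W, IsAnalytification (Fin g → ℂ)
        ((P' x).A.fibre (𝟙 (Spec (CommRingCat.of ℂ)))).toAbelianVariety.X
        ((P' x).A.fibre (𝟙 (Spec (CommRingCat.of ℂ)))).toAbelianVariety.dim (φ x)) →
      (∀ (x : W) (s t : ComplexTorus (Φ x)), φ x (s + t) = φ x s * φ x t) →
      (∀ (x : W) (a : Fin g ⊕ Fin g),
        singularCohomology.map ℚ ℚ
            (((Motives.AlgPoints.homeomorphOfIso (L := ℂ)
                (εA x) :
                ((P' x).A.fibre (𝟙 (Spec (CommRingCat.of ℂ)))).toAbelianVariety.Points ℂ ≃ₜ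
                  ComplexPoints (fiberOver f x.1)) :
              C(((P' x).A.fibre (𝟙 (Spec (CommRingCat.of ℂ)))).toAbelianVariety.Points ℂ,
                ComplexPoints (fiberOver f x.1))).comp (φ x)) 1 (γ x a) =
          latticeClass (Φ x) a) →
      (∀ x : W, (Θ x).IsAmple) →
      (∀ x : W, (P' x).A.IsLambdaOfAt (𝟙 (Spec (CommRingCat.of ℂ))) (P' x).D (P' x).pol.lam (Θ x)) →
      -- base case at `x₀`
      m₀.γ = 1 → m₀.Ψ = Φ x₀ → (∀ t : ComplexTorus (Φ x₀), m₀.toFun t = φ x₀ t) →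
      (∀ ⦃M : ℕ⦄, N ∣ M → M ≠ 0 → ∀ (c : Fin g ⊕ Fin g → ZMod M) (v : Fin g ⊕ Fin g → ℚ),
        AdelicCongr ((r⁻¹ : gspFinAdelic δ) : GL (Fin g ⊕ Fin g) finAdeleQ) 1 v (fun i => ((c i).val : ℚ) / M) →
          ((Λ₀.lift M (Multiplicative.ofAdd c)) :
              ((P' x₀).A.fibre (𝟙 (Spec (CommRingCat.of ℂ)))).toAbelianVariety.Points ℂ) = m₀.r v) →
      -- Gram `E_δ` at `x₀` in `m₀`'s currency ((G₀))
      (∀ p : ComplexTorus.AHData m₀.Ψ,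
        ComplexTorus.AHData.toPic p =
            ComplexTorus.picClass (cartierDivisorLineBundle m₀.isAnalytification (Θ x₀)) →
          ComplexTorus.intGram m₀.Ψ p.form = typeForm δ) →
      -- flat Gram ((N3-core))
      (∀ (x₁ x : W) (p₁ : ComplexTorus.AHData (Φ x₁)) (p : ComplexTorus.AHData (Φ x)),
        ComplexTorus.AHData.toPic p₁ =
            ComplexTorus.picClass (cartierDivisorLineBundle (hφ x₁) (Θ x₁)) →
        ComplexTorus.AHData.toPic p =
            ComplexTorus.picClass (cartierDivisorLineBundle (hφ x) (Θ x)) →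
        ComplexTorus.intGram (Φ x) p.form = ComplexTorus.intGram (Φ x₁) p₁.form) →
      ∃ (π : ComplexPoints S → Matrix (Fin g) (Fin g) ℂ)
        (J : W → C0pm δ)
        (mark : ∀ x : W, SiegelAdelicMarking (J x) r ((P' x).A.fibre (𝟙 (Spec (CommRingCat.of ℂ)))).toAbelianVariety),
        -- the markings ARE the given uniformisations
        (∀ x : W, (mark x).γ = 1) ∧
        (∀ x : W, (mark x).Ψ = Φ x) ∧
        (∀ (x : W) (t : ComplexTorus (Φ x)), (mark x).toFun t = φ x t) ∧
        -- `IsMarkingFrame e γ`, unfolded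
        (∀ (x : W) (a : Fin g ⊕ Fin g),
          singularCohomology.map ℚ ℚ
              (((Motives.AlgPoints.homeomorphOfIso (L := ℂ)
                  (εA x) :
                  ((P' x).A.fibre (𝟙 (Spec (CommRingCat.of ℂ)))).toAbelianVariety.Points ℂ ≃ₜ
                    ComplexPoints (fiberOver f x.1)) :
                C(((P' x).A.fibre (𝟙 (Spec (CommRingCat.of ℂ)))).toAbelianVariety.Points ℂ,
                  ComplexPoints (fiberOver f x.1))).comp
                ⟨(mark x).toFun, (mark x).isAnalytification.isHomeomorph.continuous⟩) 1 (γ x a) =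
            latticeClass (mark x).Ψ a) ∧
        -- `IsFlatGram Θ`, unfolded
        (∀ x : W, ∃ p : ComplexTorus.AHData (mark x).Ψ,
          ComplexTorus.AHData.toPic p =
              ComplexTorus.picClass (cartierDivisorLineBundle (mark x).isAnalytification (Θ x)) ∧
            ComplexTorus.intGram (mark x).Ψ p.form = typeForm δ) ∧
        -- `IsSiegelNormalised hδ (fun x ↦ π x.1)`, unfolded
        (∀ x : W, ∃ hx : π x.1 ∈ siegelUpperHalfSpace g,
          J x = ⟨jOfSiegel δ (π x.1), SiegelComplexRecordSystem.jOfSiegel_mem_C0pm hδ.1 hx⟩) ∧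
        ContinuousOn π W ∧
        (∀ x ∈ W, ∀ (i j : Fin g),
          DifferentiableOn ℂ
            ((fun y ↦ π y i j) ∘ (ComplexPoints.algebraicChart S d x).symm)
            ((ComplexPoints.algebraicChart S d x).target ∩
              (ComplexPoints.algebraicChart S d x).symm ⁻¹' W)) ∧
        π (x₀ : ComplexPoints S) = Z₀ ∧
        (∀ i : Fin g ⊕ Fin g, ∃ v : Fin g ⊕ Fin g → ℚ,
          AdelicCongr ((r⁻¹ : gspFinAdelic δ) : GL (Fin g ⊕ Fin g) finAdeleQ) 1 v
              (fun j => (((Pi.single i (1 : ZMod N) : Fin g ⊕ Fin g → ZMod N) j).val : ℚ) / N) ∧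
            (P' x₀).A.restrictPt (𝟙 (Spec (CommRingCat.of ℂ))) ((P' x₀).level.σ i) = (mark x₀).r v) := by
  intro g N δ hg hδ hN 𝒳 S f hf hS h𝒳 r d _ hr Z₀ hZ₀ W hWo _hWpc x₀ _hWc hU P' εA γ Φ φ Θ m₀ Λ₀ hN1 hφ hadd
    hframe hΘ _hlam hγ₀ hΨ₀ hu₀ htower hG₀ hconst
  have hflat := hN1.2.2
  classical
  haveI : IsLocallyNoetherian (specOver ℚ ℂ).left :=
    inferInstanceAs (IsLocallyNoetherian (Spec (CommRingCat.of ℂ)))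
  haveI : Smooth S.hom := SmoothOfRelativeDimension.smooth d _
  haveI : LocallyOfFiniteType S.hom := inferInstance
  have hN0 : N ≠ 0 := by omega
  -- (G₀) in the currency `(Φ x₀, φ x₀)`, and the Gram `E_δ` at EVERY fibre by the flat-Gram hypothesis
  have hG₀' := gramClause_of_marking m₀ hΨ₀ hu₀ (hφ x₀) (Θ x₀) hG₀
  obtain ⟨-, -, ⟨p₀, hp₀, hGp₀⟩, -⟩ := exists_marking_of_gramClause hδ _ (φ x₀) (hφ x₀) (hadd x₀) (Θ x₀) (hΘ x₀) hG₀' hr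
  have hG : ∀ (x : W) (p : ComplexTorus.AHData (Φ x)),
      ComplexTorus.AHData.toPic p = ComplexTorus.picClass (cartierDivisorLineBundle (hφ x) (Θ x)) →
        ComplexTorus.intGram (Φ x) p.form = typeForm δ := fun x p hp ↦ by
    rw [hconst x₀ x p₀ p hp₀ hp, hGp₀]
  -- the per-fibre markings (§2)
  have hfib := fun x : W ↦ exists_marking_of_gramClause hδ _ (φ x) (hφ x) (hadd x) (Θ x) (hΘ x) (hG x) hr
  choose hZ hJ hAH mark hmγ hmΨ hmu hmr using hfib
  -- the period map: `Δ · Π(Φ x)_μ⁻¹ · Π(Φ x)_λ` on `W`, `0` outside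
  set πW : W → Matrix (Fin g) (Fin g) ℂ := fun x ↦
    Matrix.diagonal (fun i ↦ (δ i : ℂ)) * ((periodMatrix (Pi.basisFun ℂ (Fin g)) (Φ x)).toCols₂)⁻¹ *
      (periodMatrix (Pi.basisFun ℂ (Fin g)) (Φ x)).toCols₁ with hπW
  set π : ComplexPoints S → Matrix (Fin g) (Fin g) ℂ := fun y ↦
    if h : y ∈ W then πW ⟨y, h⟩ else 0 with hπdef
  have hππW : ∀ x : W, π x.1 = πW x := fun x ↦ by
    simp only [hπdef, dif_pos x.2]
  -- the local period formula (§3) and what it gives in every algebraic chart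
  have hloc : ∀ (t : ComplexPoints S) (ht : t ∈ W),
      ∃ W₂ : Set (ComplexPoints S), IsOpen W₂ ∧ t ∈ W₂ ∧ W₂ ⊆ W ∧
        W₂ ⊆ (ComplexPoints.algebraicChart S d t).source ∧
        ∀ (x : ComplexPoints S) (i j : Fin g),
          DifferentiableOn ℂ
            ((fun y ↦ π y i j) ∘ (ComplexPoints.algebraicChart S d x).symm)
            ((ComplexPoints.algebraicChart S d x).target ∩
              (ComplexPoints.algebraicChart S d x).symm ⁻¹' W₂) := by
    intro t ht
    obtain ⟨W₂, hW₂o, htW₂, hW₂W, hW₂c, P, hPan, hPf⟩ := exists_local_periodMatrix_family hδ f hf hS h𝒳 d hWo hU P' εA γ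
      hflat Φ φ hφ hframe πW hZ hJ ⟨t, ht⟩
    refine ⟨W₂, hW₂o, htW₂, hW₂W, hW₂c, fun x i j ↦ ?_⟩
    set ct := ComplexPoints.algebraicChart S d t with hct
    -- in the chart at `t`: the period formula is differentiable (P4d)
    set F : ComplexPoints S → ℂ := fun y ↦
      (Matrix.diagonal (fun i ↦ (δ i : ℂ)) * ((P y).toCols₂)⁻¹ * (P y).toCols₁) i j with hFdef
    have hFt : DifferentiableOn ℂ (F ∘ ct.symm) (ct '' W₂) := by
      have h := Literature.Analysis.Matrix.differentiableOn_siegelPoint_of_periodMatrix δ (P := fun z ↦ P (ct.symm z))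
        (s := ct '' W₂) (fun i' k ↦ (hPan i' k).differentiableOn) (fun z hz ↦ ?_) i j
      · exact h
      · obtain ⟨y, hy, rfl⟩ := hz
        rw [ct.left_inv (hW₂c hy)]
        exact (hPf y (hW₂W hy) hy).1.ne_zero
    -- hence in the chart at `x` ((R-b))
    have hFx := Motives.ComplexPoints.differentiableOn_comp_algebraicChart_symm_of_differentiableOn F t hW₂o hW₂c hFt x
    refine hFx.congr fun z hz ↦ ?_
    have hyW₂ : (ComplexPoints.algebraicChart S d x).symm z ∈ W₂ := hz.2
    change π _ i j = F _
    rw [hππW ⟨_, hW₂W hyW₂⟩]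
    exact congrFun (congrFun (hPf _ (hW₂W hyW₂) hyW₂).2 i) j
  refine ⟨π, fun x ↦ ⟨jOfSiegel δ (πW x), SiegelComplexRecordSystem.jOfSiegel_mem_C0pm hδ.1 (hZ x)⟩, mark, hmγ, hmΨ, hmu,
    fun x a ↦ ?_, fun x ↦ ?_, fun x ↦ ?_, ?_, ?_, ?_, fun i ↦ ?_⟩
  · -- the frame clause in the marking's currency
    exact frameClause_to_marking (mark x) (hmΨ x) (hmu x) _ (hframe x a)
  · -- the Gram clause in the marking's currency
    exact gramClause_to_marking (mark x) (hmΨ x) (hmu x) (hφ x) (Θ x) (hAH x)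
  · -- Siegel normalisation
    refine ⟨(hππW x).symm ▸ hZ x, Subtype.ext ?_⟩
    simp only [hππW x]
  · -- continuity on `W`
    intro t ht
    obtain ⟨W₂, hW₂o, htW₂, -, hW₂c, hdiff⟩ := hloc t ht
    set ct := ComplexPoints.algebraicChart S d t with hct
    refine ContinuousAt.continuousWithinAt (continuousAt_pi.2 fun i ↦ continuousAt_pi.2 fun j ↦ ?_)
    have hopen : IsOpen (ct.target ∩ ct.symm ⁻¹' W₂) := ct.isOpen_inter_preimage_symm hW₂o
    have hmem : ct t ∈ ct.target ∩ ct.symm ⁻¹' W₂ :=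
      ⟨ct.map_source (hW₂c htW₂), by rw [Set.mem_preimage, ct.left_inv (hW₂c htW₂)]; exact htW₂⟩
    have h1 : ContinuousAt ((fun y ↦ π y i j) ∘ ct.symm) (ct t) :=
      ((hdiff t i j).differentiableAt (hopen.mem_nhds hmem)).continuousAt
    rw [ct.symm.continuousAt_iff_continuousAt_comp_right (show t ∈ ct.symm.target from hW₂c htW₂), ct.symm_symm]
    exact h1
  · -- holomorphy in every algebraic chart over `W`
    intro x hx i j z hz
    obtain ⟨W₂, hW₂o, htW₂, -, -, hdiff⟩ := hloc _ hz.2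
    set cx := ComplexPoints.algebraicChart S d x with hcx
    have hopen : IsOpen (cx.target ∩ cx.symm ⁻¹' W₂) := cx.isOpen_inter_preimage_symm hW₂o
    exact ((hdiff x i j).differentiableAt (hopen.mem_nhds ⟨hz.1, htW₂⟩)).differentiableWithinAt
  · -- `π x₀ = Z₀`
    rw [hππW x₀]
    have hJ₀ : ∀ v, Φ x₀ (jOfSiegel δ Z₀ *ᵥ v) = Complex.I • Φ x₀ v := fun v ↦ by
      have h := m₀.Ψ_J v
      have h1 : (((m₀.γ⁻¹ : GL (Fin g ⊕ Fin g) ℚ) : Matrix (Fin g ⊕ Fin g) (Fin g ⊕ Fin g) ℚ).map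
          (algebraMap ℚ ℝ)) = 1 := by
        rw [hγ₀, inv_one, Units.val_one]; exact Matrix.map_one _ (map_zero _) (map_one _)
      rw [h1, Matrix.one_mulVec, Matrix.one_mulVec, hΨ₀] at h
      exact h
    exact (siegelPoint_eq_of_apply_jOfSiegel hδ.1 hZ₀ (Φ x₀) hJ₀ (Pi.basisFun ℂ (Fin g))).2.symm
  · -- the level sections read through `mark x₀`
    obtain ⟨v, hv⟩ := SiegelAdelicMarking.exists_adelicCongr_inv_one (a := r)
      (fun j => (((Pi.single i (1 : ZMod N) : Fin g ⊕ Fin g → ZMod N) j).val : ℚ) / N)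
    refine ⟨v, hv, ?_⟩
    rw [← Λ₀.lift_level i, htower (dvd_refl N) hN0 _ v hv, m₀.r_eq_toFun_proj_of_γ_eq_one hγ₀,
      (mark x₀).r_eq_toFun_proj_of_γ_eq_one (hmγ x₀), hu₀, hmu]
    rfl

end Main

end UeP4bHodgeFrameMarkings

end Summit.HodgeConjecture.HodgeConjecture.Theorems

end
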